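import Summits.QuantumFields.BalabanUV.T4Continuum.Support.NE3TopRadiusLettersL2
import Summits.QuantumFields.BalabanUV.T4Continuum.Support.NE3ExactLineSumsTower
import HarnessLib

/-!
# NE3SlicePoincareBudgetLine (T⁴ programme, node NE3, row NE3-R2 × row K6 of route H♮) — THE k-FREE LINE BEHIND THE TWO DISPLAYED
# SMALLNESS CONDITIONS OF (P♮)_W, PART 1: the line polynomials; the letters `S_h`, `A`, `K_h` and the slice constant against them

Row NE3-R2 (`b2b-balaban-t4-ne3r2-p1`, gen 11; K-g11-1, census D-ne3r2-g11-1).  Leaf-02's K6c-2a `NE3SlicePoincareBudget.budget` (p237300) and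
K6c-2b `NE3SlicePoincareCurved.slicePoincare_frameFreeBlockLandauW` (p237604) carry two DISPLAYED smallness hypotheses `hSh : S_h ≤ 1∕2`,
`hSy : 2·K_h·S_y + s₂ ≤ 1∕2` and the constant `card n·16·A·K_h`, written out in the level letters `M = L^{k+1}`, `x`, `lr = loopRad(r_k)`,
`DS = DSum`, `S2 = S2sum`, `Λ`, `aU = radIter`.  This file (part 1 of 3) names the letter expressions of p237300 as functions (§1b, verbatim bodies) and defines the k-FREE MAJORANTS of these quantities — polynomials
`ShLine`, `ALine`, `KhLine`, `SyLine`, `sTwoLine`, `CPLine` in `(d, L, c, ε, θ)` only, every letter replaced by its K-road top in the ONE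
letter `θ ≥ M²x` (`lr ≤ 17(d+1)(d+4)θ`, `DS ≤ 20·lr`, `S2 ≤ (68∕3)(d+1)(d+4)·C2sq·θ`, `aU ≤ (17∕16)²θ`, `Λ = L^{d−2}M²`, `1∕M ≤ 1∕L`,
`√c ≤ c`) — and proves, IN THE LETTERS of p237300 (token for token), `S_h ≤ ShLine`, `A ≤ ALine`, `K_h ≤ KhLine`,
`16·A·K_h ≤ 16·ALine·KhLine`.  Part 2 (`NE3SlicePoincareBudgetLineY`) does `S_y`, `s₂`; part 3 (`NE3ClassSlicePoincare`) instantiates at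
every level and delivers the class-level (P♮) with ONE constant under four k-free numeric lines.
All [folklore]; elementary real inequalities; 0 sorry.
HONEST FRAMING.  Arithmetic on OUR displayed constants; nothing about Bałaban's minimisers; (P♮)_W is leaf-02's theorem; (ML_w) at `W ≠ 1`,
T-E_w♯ and NE3 are NOT proved; spine PROVED 0∕9; finite T⁴ rung (B)+1 — NOT infinite volume, NOT mass gap, NOT BetaPertH, NOT Clay.
PLACEMENT: `Summits/QuantumFields/BalabanUV/`.  HONEST DEPENDENCY: continuum YM on T⁴ ⇐ BetaPertH ∧ nine spine estimates (0/9 proved);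
BetaPertH ⇐ (D1) ∧ (D4) ∧ CAP+tail; G-an2-4 gates asym, D1 and NE2/3/4.
-/

set_option autoImplicit false

namespace Summit.QuantumFields.BalabanUV.T4Continuum.NE3SlicePoincareBudgetLine

open NE3CovariantLineSumsL2 (C2sq)

noncomputable section

/-! ## §1 The k-free line polynomials (every K6 letter at its K-road top in the one letter `θ`) -/

/-- Top of the loop radius letter: `lr ≤ lrTop d θ = 17(d+1)(d+4)·θ` (K-g10-1 `loopRad_iterate_le_of_levelSmall`). [folklore] -/
def lrTop (d : ℕ) (θ : ℝ) : ℝ := 17 * (((d : ℝ) + 1) * ((d : ℝ) + 4)) * θ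

/-- Top of the E∕C_J letter `4d²(M−1)²x + 16d·lr ≤ cjTop d θ`. [folklore] -/
def cjTop (d : ℕ) (θ : ℝ) : ℝ := 4 * (d : ℝ) ^ 2 * θ + 16 * d * lrTop d θ

/-- Top of the comb letter `c_f = 2(8lr) + 2(2(d−1)(M−1)Mx) ≤ cfTop d θ`. [folklore] -/
def cfTop (d : ℕ) (θ : ℝ) : ℝ := 2 * (8 * lrTop d θ) + 2 * (2 * (((d : ℝ) - 1) * θ))

/-- Top of `(1∕M + 2c_x)·M = 1 + 2M·c_x ≤ wTop d θ = 1 + 2(d−1)θ`. [folklore] -/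
def wTop (d : ℕ) (θ : ℝ) : ℝ := 1 + 2 * (((d : ℝ) - 1) * θ)

/-- Top of the defect letter block `4(2((4d+5)∕10·DS))² ≤ qTop d θ` (`DS ≤ 20·lr`). [folklore] -/
def qTop (d : ℕ) (θ : ℝ) : ℝ := 4 * (2 * ((4 * (d : ℝ) + 5) / 10 * (20 * lrTop d θ))) ^ 2

/-- Top of the ℓ²-defect letter: `S2 ≤ sTop d L θ = (68∕3)(d+1)(d+4)·C2sq d L·θ` (K-g10-2 with `√C2sq ≤ C2sq`). [folklore] -/
def sTop (d L : ℕ) (θ : ℝ) : ℝ := 68 / 3 * (((d : ℝ) + 1) * ((d : ℝ) + 4)) * C2sq d L * θ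

/-- **`ALine`**: the k-free top of `A = 18 + 1∕4 + 16·c_f·√c∕ε²`. [folklore] -/
def ALine (d : ℕ) (c ε θ : ℝ) : ℝ := 18 + 1 / 4 + 16 * cfTop d θ * c / ε ^ 2

/-- **`ShLine`**: the k-free top of `S_h`. [folklore] -/
def ShLine (d L : ℕ) (c ε θ : ℝ) : ℝ :=
  (80 * (d : ℝ) + 448) * (d : ℝ) ^ 2 * θ ^ 2 + 1 / 4 + 512 * qTop d θ * c + 16 * (((d : ℝ) - 1) * θ) * (c * d)
    + 16 * cfTop d θ * c / ε ^ 2 + ALine d c ε θ * ((2 * d * θ + 32 * d * (θ * (θ / (L : ℝ) ^ 2))) * c)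

/-- The k-free top of `g_q·8·M²`. [folklore] -/
def gTop (d : ℕ) (c θ : ℝ) : ℝ := (16 * (d : ℝ) * wTop d θ ^ 2 * (64 : ℝ) ^ d * cjTop d θ ^ 2 * c) * 8

/-- The k-free top of `b_h`. [folklore] -/
def bhTop (d L : ℕ) (c θ : ℝ) : ℝ :=
  (3 * (2 : ℝ) ^ (d + 1) + 3 * ((d : ℝ) * wTop d θ ^ 2) * (2 * (64 : ℝ) ^ d * ((2 : ℝ) ^ (3 * d + 2) * d))) * (c * (2 + 2 * qTop d θ * c))
    + (12 * d * (48 * ((d : ℝ) * (L : ℝ))) + 3 * ((d : ℝ) * (wTop d θ ^ 2 / (L : ℝ) ^ 2)) * (2 * (64 : ℝ) ^ d * (48 * ((d : ℝ) * (L : ℝ))))) * c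

/-- **`KhLine`**: the k-free top of `K_h = 1 + (1+8ε)(2 + g_q·8M²)·b_h`. [folklore] -/
def KhLine (d L : ℕ) (c ε θ : ℝ) : ℝ := 1 + (1 + 8 * ε) * (2 + gTop d c θ) * bhTop d L c θ

/-- The k-free top of `K = 8d(M·c_x)² + 2(c·C_J²)`. [folklore] -/
def kTop (d : ℕ) (c θ : ℝ) : ℝ := 8 * d * (((d : ℝ) - 1) * θ) ^ 2 + 2 * (c * cjTop d θ ^ 2)

/-- **`SyLine`**: the k-free top of `S_y`. [folklore] -/
def SyLine (d L : ℕ) (c ε θ : ℝ) : ℝ :=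
  512 * (16 * sTop d L θ ^ 2 * (L : ℝ) ^ (d - 2)) * c + 512 * (2 * ((d : ℝ) * (20 * lrTop d θ) ^ 2)) * c / ε ^ 2 + 24 * ε
    + 8 * kTop d c θ / ε + 16 * (((d : ℝ) - 1) * θ) * (c * d) / ε ^ 2 + 8 * cfTop d θ * c * d
    + ALine d c ε θ * (16 * (d : ℝ) ^ 2 * θ ^ 2 / ε ^ 2 + ε ^ 2)

/-- The k-free top of `d_K1·M²`. [folklore] -/
def dkTop (d : ℕ) (θ : ℝ) : ℝ :=
  (d : ℝ) * (2 : ℝ) ^ d * (8 * ((d : ℝ) ^ 2 * θ ^ 2) + 16 * (8 * lrTop d θ + 9 * (d : ℝ) ^ 2 * θ) ^ 2)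

/-- The k-free top of `p_K2`. [folklore] -/
def pkTop (d : ℕ) (θ : ℝ) : ℝ :=
  (2 : ℝ) ^ d * ((2 : ℝ) ^ (2 * d + 4) * (d : ℝ) ^ 2 * ((d : ℝ) - 1) ^ 2 * ((17 / 16) ^ 2 * θ) ^ 2
    + 8 * (9 * (d : ℝ) ^ 2 * θ + (d : ℝ) * (8 * lrTop d θ)) ^ 2)

/-- The k-free top of `b_y`. [folklore] -/
def byTop (d L : ℕ) (c ε θ : ℝ) : ℝ :=
  (3 * (2 : ℝ) ^ (d + 1) + 3 * ((d : ℝ) * wTop d θ ^ 2) * (2 * (64 : ℝ) ^ d * ((2 : ℝ) ^ (3 * d + 2) * d)))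
      * (c * (2 * (16 * sTop d L θ ^ 2 * (L : ℝ) ^ (d - 2)) * c) + c * (2 * (2 * ((d : ℝ) * (20 * lrTop d θ) ^ 2)) * c) / ε ^ 2)
    + (3 * dkTop d θ + 3 * ((d : ℝ) * wTop d θ ^ 2) * (2 * (64 : ℝ) ^ d * pkTop d θ)) * c / ε ^ 2

/-- The k-free top of `g_q·g_z·M²∕ε²`. [folklore] -/
def gzTop (d : ℕ) (c ε θ : ℝ) : ℝ :=
  16 * (d : ℝ) * wTop d θ ^ 2 * (64 : ℝ) ^ d * cjTop d θ ^ 2 * c * (4 * c * cjTop d θ ^ 2 + 1) / ε ^ 2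

/-- **`sTwoLine`**: the k-free top of `s₂`. [folklore] -/
def sTwoLine (d L : ℕ) (c ε θ : ℝ) : ℝ :=
  (1 + 8 * ε) * ((2 + gTop d c θ) * byTop d L c ε θ + (gTop d c θ + gzTop d c ε θ)) + 9 * ε

/-- **`SmallYLine = 2·KhLine·SyLine + sTwoLine`**: the k-free top of the second displayed smallness quantity. [folklore] -/
def SmallYLine (d L : ℕ) (c ε θ : ℝ) : ℝ := 2 * KhLine d L c ε θ * SyLine d L c ε θ + sTwoLine d L c ε θ

/-- **`CPLine = c·(16·ALine·KhLine)`**: the k-free top of the slice-Poincaré constant `card n·16·A·K_h`. [folklore] -/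
def CPLine (d L : ℕ) (c ε θ : ℝ) : ℝ := c * (16 * ALine d c ε θ * KhLine d L c ε θ)


/-! ## §1b The letter expressions of p237300, verbatim, as named functions (so that no consumer re-elaborates the long texts) -/

/-- `A = 18 + 1∕4 + 16·c_f·√c∕ε²` of p237300, verbatim in the letters `M, x, lr, ε`. [folklore] -/
def aExpr (d c : ℕ) (M x lr ε : ℝ) : ℝ := 18 + 1 / 4 + 16 * (2 * (8 * lr) + 2 * (2 * (((d : ℝ) - 1) * (M - 1) * M * x))) * (Real.sqrt ((c : ℝ))) / ε ^ 2

/-- The `hSh` quantity `S_h` of p237300 (left-hand side of `hSh`), verbatim in the letters `M, x, lr, DS, ε`. [folklore] -/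
def shExpr (d c : ℕ) (M x lr DS ε : ℝ) : ℝ := (((80 * d + 448) * (d : ℝ) ^ 2 * (M ^ 2 * x) ^ 2) + 1 / 4 + 512 * (4 * (2 * ((4 * d + 5) / 10 * DS)) ^ 2 * M ^ 2) * (c : ℝ) / M ^ 2 + 16 * (((d : ℝ) - 1) * (M - 1) * x) * (Real.sqrt ((c : ℝ) * d)) * M + 16 * (2 * (8 * lr) + 2 * (2 * (((d : ℝ) - 1) * (M - 1) * M * x))) * (Real.sqrt ((c : ℝ))) / ε ^ 2 + (18 + 1 / 4 + 16 * (2 * (8 * lr) + 2 * (2 * (((d : ℝ) - 1) * (M - 1) * M * x))) * (Real.sqrt ((c : ℝ))) / ε ^ 2) * ((2 * d * x + 32 * d * x ^ 2) * (c : ℝ) * M ^ 2))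

/-- The block `g_q·8·M²` of p237300, verbatim. [folklore] -/
def g8Expr (d c : ℕ) (M x lr : ℝ) : ℝ := (16 * (d : ℝ) * (1 / M + 2 * (((d : ℝ) - 1) * (M - 1) * x)) ^ 2 * (64 : ℝ) ^ d * (4 * (d : ℝ) ^ 2 * (M - 1) ^ 2 * x + 16 * d * lr) ^ 2 * (c : ℝ)) * 8 * M ^ 2

/-- The block `b_h` of p237300, verbatim. [folklore] -/
def bhExpr (d L c : ℕ) (M x DS : ℝ) : ℝ := (3 * ((2 : ℝ) ^ (d + 1)) * (M ^ 2)⁻¹ + 3 * ((d : ℝ) * (1 / M + 2 * (((d : ℝ) - 1) * (M - 1) * x)) ^ 2) * (2 * ((64 : ℝ) ^ d) * (((2 : ℝ) ^ (3 * d + 2)) * d))) * ((c : ℝ) * (2 * M ^ 2 + 2 * (4 * (2 * ((4 * d + 5) / 10 * DS)) ^ 2 * M ^ 2) * (c : ℝ))) + (12 * d * (48 * ((d : ℝ) * (L : ℝ))) + 3 * ((d : ℝ) * (1 / M + 2 * (((d : ℝ) - 1) * (M - 1) * x)) ^ 2) * (2 * ((64 : ℝ) ^ d) * (48 * ((d :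 ℝ) * (L : ℝ))))) * (c : ℝ)

/-- `K_h = 1 + (1+8ε)·(2 + g_q8M²)·b_h` of p237300 (unfolds to the verbatim text). [folklore] -/
def khExpr (d L c : ℕ) (M x lr DS ε : ℝ) : ℝ := 1 + (1 + 8 * ε) * (2 + g8Expr d c M x lr) * bhExpr d L c M x DS

/-- The block `S_y` of p237300, verbatim. [folklore] -/
def syExpr (d c : ℕ) (M x lr S2 Λ ε : ℝ) : ℝ := 512 * (16 * S2 ^ 2 * Λ) * (c : ℝ) / M ^ 2 + 512 * (2 * ((d : ℝ) * (20 * lr) ^ 2)) * (c : ℝ) / ε ^ 2 + 24 * ε + 8 * (8 * d * (M * (((d : ℝ) - 1) * (M - 1) * x)) ^ 2 + 2 * ((c : ℝ) * (4 * (d : ℝ) ^ 2 * (M - 1) ^ 2 * x + 16 * d * lr) ^ 2)) / ε + 16 * (((d : ℝ) - 1) * (M - 1) * x) * (Real.sqrt ((c : ℝ) * d)) * M / ε ^ 2 + 8 * (2 * (8 * lr) + 2 * (2 * (((d : ℝ) - 1) * (M - 1) * M * x))) * (Real.sqrt ((c : ℝ))) * d + (18 + 1 / 4 + 16 * (2 *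 (8 * lr) + 2 * (2 * (((d : ℝ) - 1) * (M - 1) * M * x))) * (Real.sqrt ((c : ℝ))) / ε ^ 2) * ((16 * (d : ℝ) ^ 2 * x ^ 2) * M ^ 4 / ε ^ 2 + ε ^ 2)

/-- The block `b_y` of p237300 (with its `T1` bracket and `M²∕ε²` weights), verbatim. [folklore] -/
def byExpr (d c : ℕ) (M x lr S2 Λ aU ε : ℝ) : ℝ := (3 * ((2 : ℝ) ^ (d + 1)) * (M ^ 2)⁻¹ + 3 * ((d : ℝ) * (1 / M + 2 * (((d : ℝ) - 1) * (M - 1) * x)) ^ 2) * (2 * ((64 : ℝ) ^ d) * (((2 : ℝ) ^ (3 * d + 2)) * d))) * ((c : ℝ) * (2 * (16 * S2 ^ 2 * Λ) * (c : ℝ)) + (c : ℝ) * (2 * (2 * ((d : ℝ) * (20 * lr) ^ 2)) * (c : ℝ)) * (M ^ 2 / ε ^ 2)) + (3 * ((d : ℝ) * (2 : ℝ) ^ d * (8 * ((d : ℝ) * M * x) ^ 2 + (16 / M ^ 2) * (8 * lr + 9 * (d : ℝ) ^ 2 * M ^ 2 * x) ^ 2)) + 3 * ((d : ℝ) * (1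 / M + 2 * (((d : ℝ) - 1) * (M - 1) * x)) ^ 2) * (2 * ((64 : ℝ) ^ d) * ((2 : ℝ) ^ d * ((2 : ℝ) ^ (2 * d + 4) * (d : ℝ) ^ 2 * ((d : ℝ) - 1) ^ 2 * (aU) ^ 2 + 8 * (9 * (d : ℝ) ^ 2 * M ^ 2 * x + (d : ℝ) * (8 * lr)) ^ 2)))) * (c : ℝ) * (M ^ 2 / ε ^ 2)

/-- The block `g_q·g_z·M²∕ε²` of p237300, verbatim. [folklore] -/
def gzExpr (d c : ℕ) (M x lr ε : ℝ) : ℝ := (16 * (d : ℝ) * (1 / M + 2 * (((d : ℝ) - 1) * (M - 1) * x)) ^ 2 * (64 : ℝ) ^ d * (4 * (d : ℝ) ^ 2 * (M - 1) ^ 2 * x + 16 * d * lr) ^ 2 * (c : ℝ)) * (4 * (c : ℝ) * (4 * (d : ℝ) ^ 2 * (M - 1) ^ 2 * x + 16 * d * lr) ^ 2 + 1) * (M ^ 2 / ε ^ 2)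

/-- `s₂ = (1+8ε)·((2 + g_q8M²)·b_y + (g_q8M² + g_qg_zM²∕ε²)) + 9ε` of p237300 (unfolds to the verbatim text). [folklore] -/
def sTwoExpr (d c : ℕ) (M x lr S2 Λ aU ε : ℝ) : ℝ :=
  (1 + 8 * ε) * ((2 + g8Expr d c M x lr) * byExpr d c M x lr S2 Λ aU ε + (g8Expr d c M x lr + gzExpr d c M x lr ε)) + 9 * ε

/-- **THE `hSy` QUANTITY `2·K_h·S_y + s₂`** of p237300 (left-hand side of `hSy`; unfolds to the verbatim text). [folklore] -/
def smallYExpr (d L c : ℕ) (M x lr DS S2 Λ aU ε : ℝ) : ℝ :=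
  2 * khExpr d L c M x lr DS ε * syExpr d c M x lr S2 Λ ε + sTwoExpr d c M x lr S2 Λ aU ε

/-- **THE SLICE CONSTANT `16·A·K_h`** of p237300's conclusion (K6c-2b's `SlicePoincare` constant is `card n` times it; unfolds to the
verbatim text). [folklore] -/
def cpExpr (d L c : ℕ) (M x lr DS ε : ℝ) : ℝ := 16 * aExpr d c M x lr ε * khExpr d L c M x lr DS ε

/-! ## §2 The atoms: every `M`-letter against `θ ≥ M²·x` -/

/-- THE ATOMS (`1 ≤ M`, `0 ≤ x`, `M²x ≤ θ`): `0 ≤ θ`, `(M−1)²x ≤ θ`, `(M−1)·M·x ≤ θ`, `x ≤ θ`. [folklore] -/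
theorem atoms {M x θ : ℝ} (hM : 1 ≤ M) (hx : 0 ≤ x) (hθ : M ^ 2 * x ≤ θ) :
    0 ≤ θ ∧ (M - 1) ^ 2 * x ≤ θ ∧ (M - 1) * M * x ≤ θ ∧ x ≤ θ := by
  have h0 : 0 ≤ M ^ 2 * x := by positivity
  refine ⟨h0.trans hθ, ?_, ?_, ?_⟩
  · have h1 : (M - 1) ^ 2 ≤ M ^ 2 := by nlinarith
    exact (mul_le_mul_of_nonneg_right h1 hx).trans hθ
  · have h1 : (M - 1) * M ≤ M ^ 2 := by nlinarith
    exact (mul_le_mul_of_nonneg_right h1 hx).trans hθ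
  · have h1 : (1 : ℝ) ≤ M ^ 2 := by nlinarith
    nlinarith


/-! ## §3 `S_h`, `A`: the h-side letters against the line -/

/-- **`A ≤ ALine`** (letters of p237300; `1 ≤ M`, `0 ≤ x`, `M²x ≤ θ`, `0 ≤ lr ≤ lrTop`, `1 ≤ c`, `0 < ε`). [folklore] -/
theorem A_le_line {d : ℕ} (hd : 1 ≤ d) {M x θ lr ε : ℝ} {c : ℕ} (hM : 1 ≤ M) (hx : 0 ≤ x) (hθ : M ^ 2 * x ≤ θ)
    (hlr0 : 0 ≤ lr) (hlr : lr ≤ lrTop d θ) (hc : 1 ≤ (c : ℝ)) (hε : 0 < ε) :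
    (18 + 1 / 4 + 16 * (2 * (8 * lr) + 2 * (2 * (((d : ℝ) - 1) * (M - 1) * M * x))) * (Real.sqrt ((c : ℝ))) / ε ^ 2) ≤ ALine d c ε θ := by
  obtain ⟨hθ0, -, hMMx, -⟩ := atoms hM hx hθ
  have hd1 : (1 : ℝ) ≤ d := by exact_mod_cast hd
  have hdm : (0 : ℝ) ≤ (d : ℝ) - 1 := by linarith
  have hcxM : ((d : ℝ) - 1) * (M - 1) * M * x ≤ ((d : ℝ) - 1) * θ := by
    have := mul_le_mul_of_nonneg_left hMMx hdm
    linarith [this]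
  have hcxM0 : 0 ≤ ((d : ℝ) - 1) * (M - 1) * M * x := mul_nonneg (mul_nonneg (mul_nonneg hdm (by linarith)) (by linarith)) hx
  have hcf : 2 * (8 * lr) + 2 * (2 * (((d : ℝ) - 1) * (M - 1) * M * x)) ≤ cfTop d θ := by
    unfold cfTop; linarith
  have hcf0 : 0 ≤ 2 * (8 * lr) + 2 * (2 * (((d : ℝ) - 1) * (M - 1) * M * x)) := by positivity
  have hsc : Real.sqrt (c : ℝ) ≤ c := (Real.sqrt_le_left (by positivity)).2 (by nlinarith)
  have hsc0 : 0 ≤ Real.sqrt (c : ℝ) := Real.sqrt_nonneg _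
  have hcfT0 : 0 ≤ cfTop d θ := hcf0.trans hcf
  unfold ALine
  have h1 : 16 * (2 * (8 * lr) + 2 * (2 * (((d : ℝ) - 1) * (M - 1) * M * x))) * Real.sqrt (c : ℝ) ≤ 16 * cfTop d θ * c := by
    gcongr
  have h2 := div_le_div_of_nonneg_right h1 (show 0 ≤ ε ^ 2 by positivity)
  linarith

/-- **`S_h ≤ ShLine`** (letters of p237300's `hSh`; `2 ≤ L ≤ M`, `0 ≤ x`, `M²x ≤ θ`, `0 ≤ lr ≤ lrTop`, `0 ≤ DS ≤ 20·lr`, `1 ≤ c`,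
`0 < ε`). [folklore] -/
theorem Sh_le_line {d L c : ℕ} (hd : 1 ≤ d) {M x θ lr DS ε : ℝ} (hL : 2 ≤ (L : ℝ)) (hLM : (L : ℝ) ≤ M) (hx : 0 ≤ x)
    (hθ : M ^ 2 * x ≤ θ) (hlr0 : 0 ≤ lr) (hlr : lr ≤ lrTop d θ) (hDS0 : 0 ≤ DS) (hDS : DS ≤ 20 * lr) (hc : 1 ≤ (c : ℝ))
    (hε : 0 < ε) :
    shExpr d c M x lr DS ε ≤ ShLine d L c ε θ := by
  unfold shExpr
  have hM : 1 ≤ M := by linarith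
  have hM0 : 0 < M := by linarith
  obtain ⟨hθ0, -, hMMx, hxθ⟩ := atoms hM hx hθ
  have hd1 : (1 : ℝ) ≤ d := by exact_mod_cast hd
  have hd0 : (0 : ℝ) ≤ d := by linarith
  have hdm : (0 : ℝ) ≤ (d : ℝ) - 1 := by linarith
  have hA := A_le_line hd hM hx hθ hlr0 hlr hc hε
  have hA0 : 0 ≤ (18 + 1 / 4 + 16 * (2 * (8 * lr) + 2 * (2 * (((d : ℝ) - 1) * (M - 1) * M * x))) * (Real.sqrt ((c : ℝ))) / ε ^ 2) := by
    have : 0 ≤ 2 * (8 * lr) + 2 * (2 * (((d : ℝ) - 1) * (M - 1) * M * x)) :=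
      by have := mul_nonneg (mul_nonneg (mul_nonneg hdm (show (0:ℝ) ≤ M - 1 by linarith)) hM0.le) hx; positivity
    positivity
  -- term 1
  have t1 : (80 * d + 448) * (d : ℝ) ^ 2 * (M ^ 2 * x) ^ 2 ≤ (80 * (d : ℝ) + 448) * (d : ℝ) ^ 2 * θ ^ 2 := by
    have h0 : 0 ≤ M ^ 2 * x := by positivity
    have := pow_le_pow_left₀ h0 hθ 2
    have hc0 : (0 : ℝ) ≤ (80 * d + 448) * (d : ℝ) ^ 2 := by positivity
    exact mul_le_mul_of_nonneg_left this hc0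
  -- term 2: the `M²` cancels
  have t2 : 512 * (4 * (2 * ((4 * d + 5) / 10 * DS)) ^ 2 * M ^ 2) * (c : ℝ) / M ^ 2 ≤ 512 * qTop d θ * c := by
    have e : 512 * (4 * (2 * ((4 * d + 5) / 10 * DS)) ^ 2 * M ^ 2) * (c : ℝ) / M ^ 2
        = 512 * (4 * (2 * ((4 * (d : ℝ) + 5) / 10 * DS)) ^ 2) * c := by
      field_simp
    rw [e]
    have hq : 4 * (2 * ((4 * (d : ℝ) + 5) / 10 * DS)) ^ 2 ≤ qTop d θ := by
      unfold qTop
      have hDS' : DS ≤ 20 * lrTop d θ := hDS.trans (by linarith)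
      gcongr
    have hc0 : (0 : ℝ) ≤ c := by linarith
    have := mul_le_mul_of_nonneg_right hq hc0
    linarith
  -- term 3: `c_x·M ≤ (d−1)θ`, `√(cd) ≤ cd`
  have t3 : 16 * (((d : ℝ) - 1) * (M - 1) * x) * Real.sqrt ((c : ℝ) * d) * M ≤ 16 * (((d : ℝ) - 1) * θ) * (c * d) := by
    have hcd1 : (1 : ℝ) ≤ (c : ℝ) * d := by nlinarith
    have hcd : Real.sqrt ((c : ℝ) * d) ≤ c * d := (Real.sqrt_le_left (by positivity)).2 (by nlinarith [hcd1])
    have hcd0 : 0 ≤ Real.sqrt ((c : ℝ) * d) := Real.sqrt_nonneg _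
    have e : 16 * (((d : ℝ) - 1) * (M - 1) * x) * Real.sqrt ((c : ℝ) * d) * M
        = 16 * (((d : ℝ) - 1) * ((M - 1) * M * x)) * Real.sqrt ((c : ℝ) * d) := by ring
    rw [e]
    have h1 : ((d : ℝ) - 1) * ((M - 1) * M * x) ≤ ((d : ℝ) - 1) * θ := mul_le_mul_of_nonneg_left hMMx hdm
    have h10 : 0 ≤ ((d : ℝ) - 1) * ((M - 1) * M * x) :=
      mul_nonneg hdm (mul_nonneg (mul_nonneg (by linarith) hM0.le) hx)
    gcongr
  -- term 4
  have hcxM : ((d : ℝ) - 1) * (M - 1) * M * x ≤ ((d : ℝ) - 1) * θ := by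
    have := mul_le_mul_of_nonneg_left hMMx hdm; linarith [this]
  have hcxM0 : 0 ≤ ((d : ℝ) - 1) * (M - 1) * M * x := mul_nonneg (mul_nonneg (mul_nonneg hdm (by linarith)) hM0.le) hx
  have hcf : 2 * (8 * lr) + 2 * (2 * (((d : ℝ) - 1) * (M - 1) * M * x)) ≤ cfTop d θ := by unfold cfTop; linarith
  have hsc : Real.sqrt (c : ℝ) ≤ c := (Real.sqrt_le_left (by positivity)).2 (by nlinarith)
  have hsc0 : 0 ≤ Real.sqrt (c : ℝ) := Real.sqrt_nonneg _
  have hcfT0 : 0 ≤ cfTop d θ := le_trans (by positivity) hcf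
  have t4 : 16 * (2 * (8 * lr) + 2 * (2 * (((d : ℝ) - 1) * (M - 1) * M * x))) * Real.sqrt (c : ℝ) / ε ^ 2
      ≤ 16 * cfTop d θ * c / ε ^ 2 := by
    have h1 : 16 * (2 * (8 * lr) + 2 * (2 * (((d : ℝ) - 1) * (M - 1) * M * x))) * Real.sqrt (c : ℝ) ≤ 16 * cfTop d θ * c := by
      gcongr
    exact div_le_div_of_nonneg_right h1 (by positivity)
  -- term 5: `(2dx + 32dx²)·c·M² = c·(2d(M²x) + 32d(M²x)·x)`, `x ≤ θ∕M² ≤ θ∕L²`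
  have t5 : (18 + 1 / 4 + 16 * (2 * (8 * lr) + 2 * (2 * (((d : ℝ) - 1) * (M - 1) * M * x))) * (Real.sqrt ((c : ℝ))) / ε ^ 2) * ((2 * d * x + 32 * d * x ^ 2) * (c : ℝ) * M ^ 2) ≤ ALine d c ε θ * ((2 * d * θ + 32 * d * (θ * (θ / (L : ℝ) ^ 2))) * c) := by
    have hxL : x ≤ θ / (L : ℝ) ^ 2 := by
      rw [le_div_iff₀ (by positivity)]
      have : x * (L : ℝ) ^ 2 ≤ x * M ^ 2 := by
        have hLM2 : (L : ℝ) ^ 2 ≤ M ^ 2 := by nlinarith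
        exact mul_le_mul_of_nonneg_left hLM2 hx
      linarith
    have e : (2 * d * x + 32 * d * x ^ 2) * (c : ℝ) * M ^ 2 = (2 * d * (M ^ 2 * x) + 32 * d * ((M ^ 2 * x) * x)) * c := by ring
    rw [e]
    have hin : 2 * d * (M ^ 2 * x) + 32 * d * ((M ^ 2 * x) * x) ≤ 2 * d * θ + 32 * d * (θ * (θ / (L : ℝ) ^ 2)) := by
      have hMx0 : 0 ≤ M ^ 2 * x := by positivity
      gcongr
    have hin0 : 0 ≤ 2 * d * (M ^ 2 * x) + 32 * d * ((M ^ 2 * x) * x) := by positivity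
    have hc0 : (0 : ℝ) ≤ c := by linarith
    have hAL0 : 0 ≤ ALine d c ε θ := hA0.trans hA
    calc (18 + 1 / 4 + 16 * (2 * (8 * lr) + 2 * (2 * (((d : ℝ) - 1) * (M - 1) * M * x))) * (Real.sqrt ((c : ℝ))) / ε ^ 2) * ((2 * d * (M ^ 2 * x) + 32 * d * ((M ^ 2 * x) * x)) * c)
        ≤ ALine d c ε θ * ((2 * d * (M ^ 2 * x) + 32 * d * ((M ^ 2 * x) * x)) * c) :=
          mul_le_mul_of_nonneg_right hA (mul_nonneg hin0 hc0)
      _ ≤ ALine d c ε θ * ((2 * d * θ + 32 * d * (θ * (θ / (L : ℝ) ^ 2))) * c) :=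
          mul_le_mul_of_nonneg_left (mul_le_mul_of_nonneg_right hin hc0) hAL0
  unfold ShLine
  linarith [t1, t2, t3, t4, t5]


/-! ## §4 `K_h` and the slice constant against the line -/

set_option maxHeartbeats 800000 in
/-- **`K_h ≤ KhLine`** (letters of p237300; `2 ≤ L ≤ M`, `0 ≤ x`, `M²x ≤ θ`, `0 ≤ lr ≤ lrTop`, `0 ≤ DS ≤ 20·lr`, `1 ≤ c`, `0 < ε`):
the two `M²`'s of `g_q·8M²` and of `b_h`'s first bracket CANCEL against `(1∕M + 2c_x)²` and `(M²)⁻¹`; the residual `(1∕M + 2c_x)²` of the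
second bracket is at most `wTop²∕L²`. [folklore] -/
theorem Kh_le_line {d L c : ℕ} (hd : 1 ≤ d) {M x θ lr DS ε : ℝ} (hL : 2 ≤ (L : ℝ)) (hLM : (L : ℝ) ≤ M) (hx : 0 ≤ x)
    (hθ : M ^ 2 * x ≤ θ) (hlr0 : 0 ≤ lr) (hlr : lr ≤ lrTop d θ) (hDS0 : 0 ≤ DS) (hDS : DS ≤ 20 * lr) (hc : 1 ≤ (c : ℝ))
    (hε : 0 < ε) :
    khExpr d L c M x lr DS ε ≤ KhLine d L c ε θ := by
  unfold khExpr g8Expr bhExpr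
  have hM : 1 ≤ M := by linarith
  have hM0 : 0 < M := by linarith
  have hMne : M ≠ 0 := hM0.ne'
  obtain ⟨hθ0, hM1x, hMMx, -⟩ := atoms hM hx hθ
  have hd1 : (1 : ℝ) ≤ d := by exact_mod_cast hd
  have hd0 : (0 : ℝ) ≤ d := by linarith
  have hdm : (0 : ℝ) ≤ (d : ℝ) - 1 := by linarith
  have hc0 : (0 : ℝ) ≤ c := by linarith
  have hL0 : (0 : ℝ) < L := by linarith
  set cx := ((d : ℝ) - 1) * (M - 1) * x with hcx
  set w := 1 / M + 2 * cx with hw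
  set CJ := 4 * (d : ℝ) ^ 2 * (M - 1) ^ 2 * x + 16 * d * lr with hCJ
  set qD := 4 * (2 * ((4 * (d : ℝ) + 5) / 10 * DS)) ^ 2 with hqD
  -- the atoms of this block
  have hcx0 : 0 ≤ cx := mul_nonneg (mul_nonneg hdm (by linarith)) hx
  have hMcx : M * cx ≤ ((d : ℝ) - 1) * θ := by
    have e : M * cx = ((d : ℝ) - 1) * ((M - 1) * M * x) := by rw [hcx]; ring
    rw [e]; exact mul_le_mul_of_nonneg_left hMMx hdm
  have hMcx0 : 0 ≤ M * cx := mul_nonneg hM0.le hcx0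
  have hwM : w * M = 1 + 2 * (M * cx) := by rw [hw]; field_simp
  have hwM0 : 0 ≤ w * M := by rw [hwM]; positivity
  have hwMle : w * M ≤ wTop d θ := by rw [hwM]; unfold wTop; linarith
  have hwT0 : 0 ≤ wTop d θ := hwM0.trans hwMle
  have hw0 : 0 ≤ w := by rw [hw]; positivity
  have hwle : w ≤ wTop d θ / L := by
    rw [le_div_iff₀ hL0]
    calc w * L ≤ w * M := mul_le_mul_of_nonneg_left hLM hw0
      _ ≤ wTop d θ := hwMle
  have hw2 : w ^ 2 ≤ wTop d θ ^ 2 / (L : ℝ) ^ 2 := by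
    rw [← div_pow]; exact pow_le_pow_left₀ hw0 hwle 2
  have hCJle : CJ ≤ cjTop d θ := by
    have h1 : 4 * (d : ℝ) ^ 2 * (M - 1) ^ 2 * x ≤ 4 * (d : ℝ) ^ 2 * θ := by
      have := mul_le_mul_of_nonneg_left hM1x (show (0 : ℝ) ≤ 4 * (d : ℝ) ^ 2 by positivity); linarith
    have h2 : 16 * (d : ℝ) * lr ≤ 16 * d * lrTop d θ := mul_le_mul_of_nonneg_left hlr (by positivity)
    rw [hCJ]; unfold cjTop; linarith
  have hCJ0 : 0 ≤ CJ := by rw [hCJ]; positivity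
  have hqDle : qD ≤ qTop d θ := by
    rw [hqD]; unfold qTop
    have hDS' : DS ≤ 20 * lrTop d θ := hDS.trans (by linarith)
    gcongr
  have hqD0 : 0 ≤ qD := by rw [hqD]; positivity
  -- `g_q·8·M²`
  have hG : (16 * (d : ℝ) * w ^ 2 * (64 : ℝ) ^ d * CJ ^ 2 * (c : ℝ)) * 8 * M ^ 2 ≤ gTop d c θ := by
    have e : (16 * (d : ℝ) * w ^ 2 * (64 : ℝ) ^ d * CJ ^ 2 * (c : ℝ)) * 8 * M ^ 2
        = (16 * (d : ℝ) * (w * M) ^ 2 * (64 : ℝ) ^ d * CJ ^ 2 * (c : ℝ)) * 8 := by ring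
    rw [e]; unfold gTop; gcongr
  have hG0 : 0 ≤ (16 * (d : ℝ) * w ^ 2 * (64 : ℝ) ^ d * CJ ^ 2 * (c : ℝ)) * 8 * M ^ 2 := by positivity
  -- `b_h`
  have hB : (3 * ((2 : ℝ) ^ (d + 1)) * (M ^ 2)⁻¹ + 3 * ((d : ℝ) * w ^ 2) * (2 * ((64 : ℝ) ^ d) * (((2 : ℝ) ^ (3 * d + 2)) * d)))
        * ((c : ℝ) * (2 * M ^ 2 + 2 * (qD * M ^ 2) * (c : ℝ)))
      + (12 * d * (48 * ((d : ℝ) * (L : ℝ))) + 3 * ((d : ℝ) * w ^ 2) * (2 * ((64 : ℝ) ^ d) * (48 * ((d : ℝ) * (L : ℝ))))) * (c : ℝ)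
      ≤ bhTop d L c θ := by
    have e : (3 * ((2 : ℝ) ^ (d + 1)) * (M ^ 2)⁻¹ + 3 * ((d : ℝ) * w ^ 2) * (2 * ((64 : ℝ) ^ d) * (((2 : ℝ) ^ (3 * d + 2)) * d)))
          * ((c : ℝ) * (2 * M ^ 2 + 2 * (qD * M ^ 2) * (c : ℝ)))
        = (3 * (2 : ℝ) ^ (d + 1) + 3 * ((d : ℝ) * (w * M) ^ 2) * (2 * (64 : ℝ) ^ d * ((2 : ℝ) ^ (3 * d + 2) * d)))
          * ((c : ℝ) * (2 + 2 * qD * (c : ℝ))) := by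
      field_simp
    rw [e]; unfold bhTop
    gcongr
  have hB0 : 0 ≤ (3 * ((2 : ℝ) ^ (d + 1)) * (M ^ 2)⁻¹ + 3 * ((d : ℝ) * w ^ 2) * (2 * ((64 : ℝ) ^ d) * (((2 : ℝ) ^ (3 * d + 2)) * d)))
        * ((c : ℝ) * (2 * M ^ 2 + 2 * (qD * M ^ 2) * (c : ℝ)))
      + (12 * d * (48 * ((d : ℝ) * (L : ℝ))) + 3 * ((d : ℝ) * w ^ 2) * (2 * ((64 : ℝ) ^ d) * (48 * ((d : ℝ) * (L : ℝ))))) * (c : ℝ) := by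
    positivity
  have hgT0 : 0 ≤ gTop d c θ := hG0.trans hG
  have hbT0 : 0 ≤ bhTop d L c θ := hB0.trans hB
  unfold KhLine
  gcongr

/-- **THE SLICE CONSTANT AGAINST THE LINE: `c·(16·A·K_h) ≤ CPLine`** (letters of p237300's conclusion; hypotheses as in `Kh_le_line`). [folklore] -/
theorem sliceConst_le_line {d L c : ℕ} (hd : 1 ≤ d) {M x θ lr DS ε : ℝ} (hL : 2 ≤ (L : ℝ)) (hLM : (L : ℝ) ≤ M) (hx : 0 ≤ x)
    (hθ : M ^ 2 * x ≤ θ) (hlr0 : 0 ≤ lr) (hlr : lr ≤ lrTop d θ) (hDS0 : 0 ≤ DS) (hDS : DS ≤ 20 * lr) (hc : 1 ≤ (c : ℝ))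
    (hε : 0 < ε) :
    (c : ℝ) * cpExpr d L c M x lr DS ε ≤ CPLine d L c ε θ := by
  unfold cpExpr aExpr
  have hM : 1 ≤ M := by linarith
  have hM0 : 0 < M := by linarith
  have hd1 : (1 : ℝ) ≤ d := by exact_mod_cast hd
  have hdm : (0 : ℝ) ≤ (d : ℝ) - 1 := by linarith
  have hc0 : (0 : ℝ) ≤ c := by linarith
  have hA := A_le_line hd hM hx hθ hlr0 hlr hc hε
  have hK := Kh_le_line hd hL hLM hx hθ hlr0 hlr hDS0 hDS hc hε
  have hcxM0 : 0 ≤ ((d : ℝ) - 1) * (M - 1) * M * x := mul_nonneg (mul_nonneg (mul_nonneg hdm (by linarith)) hM0.le) hx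
  have hcx0 : 0 ≤ ((d : ℝ) - 1) * (M - 1) * x := mul_nonneg (mul_nonneg hdm (by linarith)) hx
  have hA0 : 0 ≤ (18 + 1 / 4 + 16 * (2 * (8 * lr) + 2 * (2 * (((d : ℝ) - 1) * (M - 1) * M * x))) * (Real.sqrt ((c : ℝ))) / ε ^ 2) := by positivity
  have hK0 : 0 ≤ khExpr d L c M x lr DS ε := by unfold khExpr g8Expr bhExpr; positivity
  have hAL0 : 0 ≤ ALine d c ε θ := hA0.trans hA
  unfold CPLine
  gcongr

end

end Summit.QuantumFields.BalabanUV.T4Continuum.NE3SlicePoincareBudgetLine
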